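import Literature.NumberTheory.Transcendental.MasserThmIMain
import HarnessLib

/-!
# Masser 1975 — `τ = ω₂/ω₁` is transcendental (no complex multiplication): the arithmetic

Support for the book's own proof (Ch. II) of
`Literature.NumberTheory.Transcendental.masser_ellipticPeriods` (Masser 1975, Theorem II): the
proof of Theorem II (§2.5, p. 26) uses that "`ω₂/ω₁` is transcendental" (Schneider 1937), which
in the book is the qualitative content of Theorem I (Ch. I, all degrees `d`). The tree has
Theorem I for `d = 2` (`masser_thmI_quadratic`); here we run the SAME argument of §1.3 once more
for a FIXED algebraic `τ` satisfying no integer quadratic relation (degree `≥ 3`), with `α = τ`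
exactly (`E = 0`): the number field is now `K = ℚ(g₂/2, ℘(ωᵢ/4), ℘'(ωᵢ/4), τ)` itself, so no
uniformity and no reduction of the powers of `α` is needed.

This file: the linear system over `𝓞 K` (polynomials `V m λ₁ λ₂ ∈ ℤ[a, x]` with
`A_m(τ) = ∑ p(λ₁,λ₂) V m λ₁ λ₂ (a, τ)`), Siegel's lemma (`exists_solution6`), the algebraic
integers `d^{2n+2K} A_m(τ)` with their conjugate bounds (`exists_Z`), and the Liouville lower
bound for `A + Bτ + Cτ²` (`norm_quadForm_tau_ge`). The analytic run and the parameters are the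
sequel. Everything here is proved; no named facts.

## References

* D. W. Masser, *Elliptic Functions and Transcendence*, Lecture Notes in Math. 437, Springer 1975,
  Ch. I §1.3 (proof of Theorem I) and Ch. II §2.5 (p. 26, "ω₂/ω₁ is transcendental"). [Masser1975]
* Th. Schneider, *Arithmetische Untersuchungen elliptischer Integrale*, Math. Ann. 113 (1937). [Schneider1937]
-/

noncomputable section

open Complex MvPolynomial NumberField Finset
open scoped PeriodPair

namespace Literature.NumberTheory.Transcendental.Masser1975

open Literature.NumberTheory.Transcendental.Chudnovsky (l1 wnorm wnorm_mul_le wnorm_nonneg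
  normRingSeminorm_int_apply norm_aeval_le_l1 l1_aeval_le totalDegree_aeval_le_of_le_one)

/-! ### The data: a lattice with algebraic invariants and algebraic `τ` of degree `≥ 3` -/

/-- A lattice with algebraic invariants whose `τ = ω₂/ω₁` is ALGEBRAIC and satisfies no integer
quadratic relation (the situation to be shown impossible). [cite: Masser1975, Thm I / §2.5 (p. 26)] -/
structure ASetup extends TSetup where
  /-- `τ` is algebraic -/
  hτ : IsAlgebraic ℚ (L.ω₂ / L.ω₁)
  /-- no integer quadratic relation -/
  hdeg : ∀ A B C : ℤ, (A, B, C) ≠ (0, 0, 0) →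
    (A : ℂ) + (B : ℂ) * (L.ω₂ / L.ω₁) + (C : ℂ) * (L.ω₂ / L.ω₁) ^ 2 ≠ 0

namespace ASetup

variable (S : ASetup)

/-- `τ = ω₂/ω₁`. [folklore] -/
def τ : ℂ := S.L.ω₂ / S.L.ω₁

/-- The six generators `(g₂/2, ℘(ω₁/4), ℘'(ω₁/4), ℘(ω₂/4), ℘'(ω₂/4), τ)`. [folklore] -/
def xv6 : Fin 6 → ℂ := ![xv S.L 0, xv S.L 1, xv S.L 2, xv S.L 3, xv S.L 4, S.τ]

/-- They are algebraic. [folklore] -/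
theorem isAlgebraic_xv6 (t : Fin 6) : IsAlgebraic ℚ (S.xv6 t) := by
  have h := S.toTSetup.isAlgebraic_xv
  fin_cases t
  · exact h 0
  · exact h 1
  · exact h 2
  · exact h 3
  · exact h 4
  · exact S.hτ

/-- The algebraic data with `τ` adjoined. [folklore] -/
abbrev G6 : AlgGens := ⟨Fin 6, S.xv6, S.isAlgebraic_xv6⟩

/-- The number field `K = ℚ(a, τ) ⊆ ℂ`. [folklore] -/
abbrev K6 : IntermediateField ℚ ℂ := S.G6.K

/-- Its common denominator. [folklore] -/
abbrev d6 : ℤ := S.G6.den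

/-- The size constant `C₆ = |d| M ≥ 1`. [folklore] -/
def C6 : ℝ := |(S.d6 : ℝ)| * S.G6.M

/-- `1 ≤ C₆`. [folklore] -/
theorem one_le_C6 : 1 ≤ S.C6 := one_le_mul_of_one_le_of_one_le S.G6.one_le_abs_den S.G6.one_le_M

/-- The specialisation `ℤ[a, x] → ℂ`, `x ↦ τ`. [folklore] -/
abbrev φ6 : MvPolynomial (Fin 6) ℤ →+* ℂ := (MvPolynomial.aeval S.xv6 : MvPolynomial (Fin 6) ℤ →ₐ[ℤ] ℂ).toRingHom

/-- The inclusion `ℤ[a] → ℤ[a, x]`. [folklore] -/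
def ι6 : Fin 5 → MvPolynomial (Fin 6) ℤ := fun t => X (Fin.castSucc t)

/-- `φ6 ∘ ι6 = φx`. [folklore] -/
theorem φ6_aeval_ι6 (P : MvPolynomial (Fin 5) ℤ) : S.φ6 (MvPolynomial.aeval ι6 P) = φx S.L P := by
  have h : ((MvPolynomial.aeval S.xv6 : MvPolynomial (Fin 6) ℤ →ₐ[ℤ] ℂ).comp
      (MvPolynomial.aeval ι6 : MvPolynomial (Fin 5) ℤ →ₐ[ℤ] MvPolynomial (Fin 6) ℤ)) =
      (MvPolynomial.aeval (xv S.L) : MvPolynomial (Fin 5) ℤ →ₐ[ℤ] ℂ) := by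
    refine MvPolynomial.algHom_ext fun t => ?_
    rw [AlgHom.comp_apply, MvPolynomial.aeval_X, MvPolynomial.aeval_X]
    unfold ι6
    rw [MvPolynomial.aeval_X]
    fin_cases t <;> rfl
  exact AlgHom.congr_fun h P

/-- `φ6 (X 5) = τ`. [folklore] -/
theorem φ6_X5 : S.φ6 (X 5) = S.τ := by
  change MvPolynomial.aeval S.xv6 (X 5) = S.τ
  rw [MvPolynomial.aeval_X]; rfl

/-- The inclusion `K ⊆ ℂ` applied to `P(genK)` is `φ6 P`. [folklore] -/
theorem coe_aeval_genK6 (P : MvPolynomial (Fin 6) ℤ) :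
    ((MvPolynomial.aeval S.G6.genK P : S.K6) : ℂ) = S.φ6 P :=
  (MvPolynomial.aeval_algebraMap_apply (R := ℤ) (B := ℂ) S.G6.genK P).symm

/-- `∑ |coeff| = l1`. [folklore] -/
theorem sum_abs_coeff_eq_l1' (P : MvPolynomial (Fin 6) ℤ) :
    (∑ a ∈ P.support, |((P.coeff a : ℤ) : ℝ)|) = l1 P := by
  unfold l1 Chudnovsky.wnorm
  simp only [Chudnovsky.normRingSeminorm_int_apply]

/-! ### The polynomials `V m λ₁ λ₂ ∈ ℤ[a, x]` -/

/-- `V m λ₁ λ₂ = ∑_μ binom(m,μ) x^{m-μ} U₁(λ₁, μ) U₂(λ₂, m-μ)`, so that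
`A_m(τ) = ∑ p(λ₁,λ₂) V m λ₁ λ₂ (a, τ)`. [cite: Masser1975, §1.3 (proof of Lemma 1.8, A_m)] -/
def V (m i j : ℕ) : MvPolynomial (Fin 6) ℤ :=
  ∑ μ ∈ Finset.range (m + 1), (m.choose μ : ℤ) •
    (X 5 ^ (m - μ) * (MvPolynomial.aeval ι6 (U₁ i μ) * MvPolynomial.aeval ι6 (U₂ j (m - μ))))

/-- `φ6 (V m λ₁ λ₂)` is the inner sum of `A_m(τ)`. [folklore] -/
theorem φ6_V (m i j : ℕ) : S.φ6 (V m i j) =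
    ∑ μ ∈ Finset.range (m + 1), (m.choose μ : ℂ) * S.τ ^ (m - μ) * (φx S.L (U₁ i μ) * φx S.L (U₂ j (m - μ))) := by
  unfold V
  rw [map_sum]
  refine Finset.sum_congr rfl fun μ _ => ?_
  rw [map_zsmul, map_mul, map_mul, map_pow, φ6_X5, φ6_aeval_ι6, φ6_aeval_ι6, zsmul_eq_mul]
  push_cast; ring

/-- **`A_m(τ) = ∑ p(λ₁,λ₂) (V m λ₁ λ₂)(a, τ)`**. [cite: Masser1975, §1.3 (proof of Lemma 1.8)] -/
theorem Aval_tau_eq (n : ℕ) (p : ℕ → ℕ → ℂ) (m : ℕ) :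
    Aval S.L n p m S.τ = ∑ i ∈ Finset.range (n + 1), ∑ j ∈ Finset.range (n + 1), p i j * S.φ6 (V m i j) := by
  unfold Aval
  refine Finset.sum_congr rfl fun i _ => Finset.sum_congr rfl fun j _ => ?_
  rw [φ6_V]

/-- The images of `ι6` have degree `≤ 1` and height `≤ 1`. [folklore] -/
theorem totalDegree_ι6_le (t : Fin 5) : (ι6 t).totalDegree ≤ 1 := by
  unfold ι6; rw [totalDegree_X]

/-- Heights of the images of `ι6`. [folklore] -/
theorem l1_ι6_le (t : Fin 5) : l1 (ι6 t) ≤ 1 := by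
  unfold ι6 l1
  rw [Chudnovsky.wnorm_X, Chudnovsky.normRingSeminorm_int_apply]; simp

/-- **Degree bound** `deg V ≤ λ₁ + λ₂ + 2m`. [folklore] -/
theorem totalDegree_V_le (m i j : ℕ) : (V m i j).totalDegree ≤ i + j + 2 * m := by
  unfold V
  refine (totalDegree_finsetSum _ _).trans (Finset.sup_le fun μ hμ => ?_)
  have hμ : μ ≤ m := Nat.lt_succ_iff.mp (Finset.mem_range.mp hμ)
  refine (totalDegree_smul_le _ _).trans ((totalDegree_mul _ _).trans ?_)
  have h0 : ((X 5 : MvPolynomial (Fin 6) ℤ) ^ (m - μ)).totalDegree ≤ m - μ :=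
    (totalDegree_pow _ _).trans (by rw [totalDegree_X]; omega)
  have h1 : (MvPolynomial.aeval ι6 (U₁ i μ)).totalDegree ≤ i + μ :=
    (totalDegree_aeval_le_of_le_one _ totalDegree_ι6_le _).trans (totalDegree_U₁_le i μ)
  have h2 : (MvPolynomial.aeval ι6 (U₂ j (m - μ))).totalDegree ≤ j + (m - μ) :=
    (totalDegree_aeval_le_of_le_one _ totalDegree_ι6_le _).trans (totalDegree_U₂_le j (m - μ))
  have h12 := (totalDegree_mul (MvPolynomial.aeval ι6 (U₁ i μ)) (MvPolynomial.aeval ι6 (U₂ j (m - μ)))).trans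
    (add_le_add h1 h2)
  omega

/-- **Height bound** `l1 V ≤ (14(λ₁+λ₂+m+1))^m`. [folklore] -/
theorem l1_V_le (m i j : ℕ) : l1 (V m i j) ≤ (14 * ((i : ℝ) + j + m + 1)) ^ m := by
  set N : ℝ := 7 * ((i : ℝ) + j + m + 1) with hN
  have hN1 : 1 ≤ N := by
    rw [hN]; have : (0:ℝ) ≤ i + j + m := by positivity
    linarith
  have hterm : ∀ μ ∈ Finset.range (m + 1),
      l1 ((m.choose μ : ℤ) • (X 5 ^ (m - μ) * (MvPolynomial.aeval ι6 (U₁ i μ) *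
        MvPolynomial.aeval ι6 (U₂ j (m - μ))))) ≤ (m.choose μ : ℝ) * N ^ m := by
    intro μ hμ
    have hμ : μ ≤ m := Nat.lt_succ_iff.mp (Finset.mem_range.mp hμ)
    refine (Chudnovsky.l1_zsmul_le _ _).trans ?_
    rw [Int.cast_natCast, Nat.abs_cast]
    refine mul_le_mul_of_nonneg_left ?_ (Nat.cast_nonneg _)
    have hx : l1 ((X 5 : MvPolynomial (Fin 6) ℤ) ^ (m - μ)) ≤ 1 :=
      Chudnovsky.wnorm_X_pow_le _ (by simp [Chudnovsky.normRingSeminorm_int_apply]) _ _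
    have h1 : l1 (MvPolynomial.aeval ι6 (U₁ i μ)) ≤ N ^ μ := by
      refine (l1_aeval_le ι6 le_rfl l1_ι6_le _).trans ?_
      rw [one_pow, mul_one]
      refine (l1_U₁_le i μ).trans (pow_le_pow_left₀ (by positivity) ?_ μ)
      rw [hN]
      have : (μ : ℝ) ≤ m := by exact_mod_cast hμ
      nlinarith
    have h2 : l1 (MvPolynomial.aeval ι6 (U₂ j (m - μ))) ≤ N ^ (m - μ) := by
      refine (l1_aeval_le ι6 le_rfl l1_ι6_le _).trans ?_
      rw [one_pow, mul_one]
      refine (l1_U₂_le j (m - μ)).trans (pow_le_pow_left₀ (by positivity) ?_ _)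
      rw [hN]
      have : ((m - μ : ℕ) : ℝ) ≤ m := by exact_mod_cast Nat.sub_le m μ
      nlinarith
    calc l1 (X 5 ^ (m - μ) * (MvPolynomial.aeval ι6 (U₁ i μ) * MvPolynomial.aeval ι6 (U₂ j (m - μ))))
        ≤ l1 ((X 5 : MvPolynomial (Fin 6) ℤ) ^ (m - μ)) *
            (l1 (MvPolynomial.aeval ι6 (U₁ i μ)) * l1 (MvPolynomial.aeval ι6 (U₂ j (m - μ)))) :=
          (wnorm_mul_le _ _ _).trans (mul_le_mul_of_nonneg_left (wnorm_mul_le _ _ _) (wnorm_nonneg _ _))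
      _ ≤ 1 * (N ^ μ * N ^ (m - μ)) :=
          mul_le_mul hx (mul_le_mul h1 h2 (wnorm_nonneg _ _) (by positivity)) (by
            exact mul_nonneg (wnorm_nonneg _ _) (wnorm_nonneg _ _)) zero_le_one
      _ = N ^ m := by rw [one_mul, ← pow_add, Nat.add_sub_cancel' hμ]
  unfold V
  refine (Chudnovsky.wnorm_sum_le _ _ _).trans ((Finset.sum_le_sum hterm).trans ?_)
  rw [← Finset.sum_mul]
  have hsum : ∑ μ ∈ Finset.range (m + 1), (m.choose μ : ℝ) = 2 ^ m := by
    have := Nat.sum_range_choose m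
    exact_mod_cast this
  rw [hsum, ← mul_pow]
  refine pow_le_pow_left₀ (by positivity) ?_ m
  rw [hN]; ring_nf; exact le_rfl

/-! ### Sizes of the values and the linear system over `𝓞 K` -/

/-- The house bound `Amat₆(n, k) = C₆^{2n+2k} (14(2n+k+1))^k` for `d^{2n+2k} V(a, τ)`
(`λᵢ ≤ n`, `m ≤ k`). [cite: Masser1975, §1.3 (proof of Lemma 1.8, sizes)] -/
def Amat6 (n k : ℕ) : ℝ := S.C6 ^ (2 * n + 2 * k) * (14 * ((2 * n + k + 1 : ℕ) : ℝ)) ^ k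

/-- `1 ≤ Amat₆`. [folklore] -/
theorem one_le_Amat6 (n k : ℕ) : 1 ≤ S.Amat6 n k := by
  unfold Amat6
  refine one_le_mul_of_one_le_of_one_le (one_le_pow₀ S.one_le_C6) (one_le_pow₀ ?_)
  have : (1 : ℝ) ≤ ((2 * n + k + 1 : ℕ) : ℝ) := by exact_mod_cast (by omega : 1 ≤ 2 * n + k + 1)
  linarith

/-- **Size of the values**: every conjugate of `V(genK)` is `≤ (14(2n+k+1))^k M^{2n+2k}`.
[cite: Masser1975, §1.3 (proof of Lemma 1.8, eq. (9))] -/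
theorem norm_embedding_aeval_V_le (σ : S.K6 →+* ℂ) {n k m i j : ℕ} (hi : i ≤ n) (hj : j ≤ n) (hm : m ≤ k) :
    ‖σ (MvPolynomial.aeval S.G6.genK (V m i j))‖ ≤ (14 * ((2 * n + k + 1 : ℕ) : ℝ)) ^ k * S.G6.M ^ (2 * n + 2 * k) := by
  have hdeg : (V m i j).totalDegree ≤ 2 * n + 2 * k := (totalDegree_V_le m i j).trans (by omega)
  have h1 := S.G6.norm_embedding_aeval_le σ (V m i j) hdeg
  rw [sum_abs_coeff_eq_l1'] at h1
  refine h1.trans (mul_le_mul_of_nonneg_right ?_ (pow_nonneg (zero_le_one.trans S.G6.one_le_M) _))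
  refine (l1_V_le m i j).trans ?_
  have hb : 14 * ((i : ℝ) + j + m + 1) ≤ 14 * ((2 * n + k + 1 : ℕ) : ℝ) := by
    push_cast
    have : (i : ℝ) + j + m ≤ 2 * n + k := by exact_mod_cast (by omega : i + j + m ≤ 2 * n + k)
    linarith
  have hb1 : (1 : ℝ) ≤ 14 * ((2 * n + k + 1 : ℕ) : ℝ) := by
    have : (1 : ℝ) ≤ ((2 * n + k + 1 : ℕ) : ℝ) := by exact_mod_cast (by omega : 1 ≤ 2 * n + k + 1)
    linarith
  exact (pow_le_pow_left₀ (by positivity) hb _).trans (pow_le_pow_right₀ hb1 hm)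

/-- **Size of the cleared values**: every conjugate of `d^{2n+2k} V(genK)` is `≤ Amat₆(n, k)`.
[cite: Masser1975, §1.3 (proof of Lemma 1.8)] -/
theorem norm_embedding_den_pow_mul_aeval_V_le (σ : S.K6 →+* ℂ) {n k m i j : ℕ}
    (hi : i ≤ n) (hj : j ≤ n) (hm : m ≤ k) :
    ‖σ ((S.d6 : S.K6) ^ (2 * n + 2 * k) * MvPolynomial.aeval S.G6.genK (V m i j))‖ ≤ S.Amat6 n k := by
  rw [map_mul, map_pow, norm_mul, norm_pow, map_intCast, Complex.norm_intCast]
  have h1 := S.norm_embedding_aeval_V_le σ hi hj hm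
  unfold Amat6 C6
  rw [mul_pow]
  have h0 : 0 ≤ |(S.d6 : ℝ)| ^ (2 * n + 2 * k) := by positivity
  calc |(S.d6 : ℝ)| ^ (2 * n + 2 * k) * ‖σ (MvPolynomial.aeval S.G6.genK (V m i j))‖
      ≤ |(S.d6 : ℝ)| ^ (2 * n + 2 * k) * ((14 * ((2 * n + k + 1 : ℕ) : ℝ)) ^ k * S.G6.M ^ (2 * n + 2 * k)) :=
        mul_le_mul_of_nonneg_left h1 h0
    _ = _ := by ring

section System

variable (n k : ℕ)

/-- The matrix of the `k+1` conditions `A_m(τ) = 0` in the `(n+1)²` unknowns `p(λ₁,λ₂)`, entries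
`d^{2n+2k} (V m λ₁ λ₂)(genK) ∈ 𝓞 K`. [cite: Masser1975, §1.3 (proof of Lemma 1.8)] -/
def Mat6 : Matrix (Fin (k + 1)) (Fin (n + 1) × Fin (n + 1)) (𝓞 S.K6) := fun m ij =>
  ⟨(S.d6 : S.K6) ^ (2 * n + 2 * k) * MvPolynomial.aeval S.G6.genK (V m ij.1 ij.2),
    S.G6.isIntegral_den_pow_mul_aeval _ ((totalDegree_V_le _ _ _).trans (by
      have := ij.1.isLt; have := ij.2.isLt; have := m.isLt; omega))⟩

variable {n k}

/-- The entries of `Mat6` as complex numbers. [folklore] -/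
theorem coe_Mat6 (m : Fin (k + 1)) (ij : Fin (n + 1) × Fin (n + 1)) :
    ((S.Mat6 n k m ij : S.K6) : ℂ) = (S.d6 : ℂ) ^ (2 * n + 2 * k) * S.φ6 (V m ij.1 ij.2) := by
  simp only [Mat6, RingOfIntegers.map_mk]
  push_cast
  rw [coe_aeval_genK6]

/-- The coefficient family as a function `ℕ → ℕ → ℂ` (zero beyond `n`). [folklore] -/
def pFun6 (ξ : Fin (n + 1) × Fin (n + 1) → 𝓞 S.K6) : ℕ → ℕ → ℂ := fun i j =>
  if h : i < n + 1 ∧ j < n + 1 then ((ξ (⟨i, h.1⟩, ⟨j, h.2⟩) : S.K6) : ℂ) else 0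

/-- `pFun6` at admissible indices. [folklore] -/
theorem pFun6_apply (ξ : Fin (n + 1) × Fin (n + 1) → 𝓞 S.K6) (ij : Fin (n + 1) × Fin (n + 1)) :
    S.pFun6 ξ ij.1 ij.2 = ((ξ ij : S.K6) : ℂ) := by
  unfold pFun6
  rw [dif_pos ⟨ij.1.isLt, ij.2.isLt⟩]

/-- `‖pFun6 ξ i j‖ ≤ P` when all `house ξ ≤ P`. [folklore] -/
theorem norm_pFun6_le (ξ : Fin (n + 1) × Fin (n + 1) → 𝓞 S.K6) {P : ℝ} (hP0 : 0 ≤ P)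
    (hP : ∀ ij, house ((ξ ij : 𝓞 S.K6) : S.K6) ≤ P) (i j : ℕ) : ‖S.pFun6 ξ i j‖ ≤ P := by
  unfold pFun6
  split_ifs with h
  · exact (NumberField.norm_embedding_le_house _ (algebraMap S.K6 ℂ)).trans (hP _)
  · simpa using hP0

/-- **Liouville for the coefficients**: a non-zero `p(λ₁,λ₂)` with `house ≤ P` (`P ≥ 1`) has
`|p| ≥ P^{-(h-1)}`. [cite: Masser1975, §1.3 (end of the proof of Thm I)] -/
theorem norm_pFun6_ge (ξ : Fin (n + 1) × Fin (n + 1) → 𝓞 S.K6) {P : ℝ} (hP1 : 1 ≤ P)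
    (hP : ∀ ij, house ((ξ ij : 𝓞 S.K6) : S.K6) ≤ P) (ij : Fin (n + 1) × Fin (n + 1)) (hξ : ξ ij ≠ 0) :
    (P ^ (S.G6.h - 1))⁻¹ ≤ ‖S.pFun6 ξ ij.1 ij.2‖ := by
  rw [pFun6_apply]
  exact S.G6.norm_ge_of_forall_norm_le hξ hP1 fun σ =>
    (NumberField.norm_embedding_le_house _ σ).trans (hP ij)

/-- The houses of the entries of `Mat6` are bounded by `Amat₆(n, k)`. [folklore] -/
theorem house_Mat6_le (m : Fin (k + 1)) (ij : Fin (n + 1) × Fin (n + 1)) :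
    house (algebraMap (𝓞 S.K6) S.K6 (S.Mat6 n k m ij)) ≤ S.Amat6 n k := by
  refine S.G6.house_le_of_forall_norm_le (zero_le_one.trans (S.one_le_Amat6 n k)) fun σ => ?_
  exact S.norm_embedding_den_pow_mul_aeval_V_le σ (Nat.lt_succ_iff.mp ij.1.isLt)
    (Nat.lt_succ_iff.mp ij.2.isLt) (Nat.lt_succ_iff.mp m.isLt)

/-- The house bound produced by Siegel's lemma: `Pb₆ = C_K (C_K (n+1)² Amat₆)`. [folklore] -/
def Pb6 (n k : ℕ) : ℝ := siegelConst S.K6 * (siegelConst S.K6 * (((n + 1) ^ 2 : ℕ) : ℝ) * S.Amat6 n k)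

/-- `1 ≤ Pb₆`. [folklore] -/
theorem one_le_Pb6 (n k : ℕ) : 1 ≤ S.Pb6 n k := by
  have hC := one_le_siegelConst S.K6
  have hA := S.one_le_Amat6 n k
  have hq : (1 : ℝ) ≤ (((n + 1) ^ 2 : ℕ) : ℝ) := by exact_mod_cast Nat.one_le_pow _ _ (by omega)
  unfold Pb6
  exact one_le_mul_of_one_le_of_one_le hC
    (one_le_mul_of_one_le_of_one_le (one_le_mul_of_one_le_of_one_le hC hq) hA)

/-- **Siegel's lemma step**: if `(n+1)² ≥ 2(k+1)` there is a non-zero `ξ ∈ 𝓞 K^{(n+1)²}` with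
`Mat6 ξ = 0` and `house ξ(λ₁,λ₂) ≤ Pb₆(n, k)`. [cite: Masser1975, Lemma 1.8] -/
theorem exists_solution6 (hq : 2 * (k + 1) ≤ (n + 1) ^ 2) :
    ∃ ξ : Fin (n + 1) × Fin (n + 1) → 𝓞 S.K6, ξ ≠ 0 ∧ (S.Mat6 n k).mulVec ξ = 0 ∧
      ∀ ij, house ((ξ ij : 𝓞 S.K6) : S.K6) ≤ S.Pb6 n k := by
  have hrows : Fintype.card (Fin (k + 1)) = k + 1 := by simp
  have hcols : Fintype.card (Fin (n + 1) × Fin (n + 1)) = (n + 1) ^ 2 := by simp [sq]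
  have hpos : 0 < k + 1 := by omega
  have hlt : k + 1 < (n + 1) ^ 2 := by omega
  haveI : Nonempty (Fin (n + 1) × Fin (n + 1)) := ⟨(0, 0)⟩
  have hA : (1 : ℝ) ≤ S.Amat6 n k := S.one_le_Amat6 n k
  obtain ⟨ξ, hξ0, hMξ, hhouse⟩ :=
    siegel_house S.K6 (S.Mat6 n k) hpos hlt hrows hcols hA (fun m ij => S.house_Mat6_le m ij)
  refine ⟨ξ, hξ0, hMξ, fun ij => (hhouse ij).trans ?_⟩
  have hC := one_le_siegelConst S.K6
  have hbase1 : 1 ≤ siegelConst S.K6 * (((n + 1) ^ 2 : ℕ) : ℝ) * S.Amat6 n k := by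
    have hq1 : (1 : ℝ) ≤ (((n + 1) ^ 2 : ℕ) : ℝ) := by exact_mod_cast Nat.one_le_pow _ _ (by omega)
    exact one_le_mul_of_one_le_of_one_le (one_le_mul_of_one_le_of_one_le hC hq1) hA
  have hexp : ((k + 1 : ℕ) : ℝ) / ((((n + 1) ^ 2 : ℕ) : ℝ) - ((k + 1 : ℕ) : ℝ)) ≤ 1 := by
    have hq' : (2 : ℝ) * (k + 1) ≤ (((n + 1) ^ 2 : ℕ) : ℝ) := by exact_mod_cast hq
    rw [div_le_one (by push_cast at hq' ⊢; linarith)]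
    push_cast at hq' ⊢
    linarith
  have hpow : (siegelConst S.K6 * (((n + 1) ^ 2 : ℕ) : ℝ) * S.Amat6 n k) ^
      (((k + 1 : ℕ) : ℝ) / ((((n + 1) ^ 2 : ℕ) : ℝ) - ((k + 1 : ℕ) : ℝ))) ≤
      siegelConst S.K6 * (((n + 1) ^ 2 : ℕ) : ℝ) * S.Amat6 n k := by
    conv_rhs => rw [← Real.rpow_one (siegelConst S.K6 * (((n + 1) ^ 2 : ℕ) : ℝ) * S.Amat6 n k)]
    exact Real.rpow_le_rpow_of_exponent_le hbase1 hexp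
  unfold Pb6
  exact mul_le_mul_of_nonneg_left hpow (zero_le_one.trans hC)

/-- `Mat6 ξ` encodes `d^{2n+2k} A_m(τ)`. [folklore] -/
theorem coe_mulVec6 (ξ : Fin (n + 1) × Fin (n + 1) → 𝓞 S.K6) (m : Fin (k + 1)) :
    ((((S.Mat6 n k).mulVec ξ) m : S.K6) : ℂ) =
      (S.d6 : ℂ) ^ (2 * n + 2 * k) * Aval S.L n (S.pFun6 ξ) m S.τ := by
  rw [Aval_tau_eq, TSetup.sum_range_range_eq_sum_fin, Finset.mul_sum]
  simp only [Matrix.mulVec, dotProduct, map_sum, map_mul]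
  push_cast
  refine Finset.sum_congr rfl fun ij _ => ?_
  rw [S.coe_Mat6 m ij, pFun6_apply]
  ring

/-- **The conditions hold**: if `Mat6 ξ = 0` then `A_m(τ) = 0` for all `m ≤ k`.
[cite: Masser1975, Lemma 1.8 (A_m = 0)] -/
theorem Aval_tau_eq_zero_of_mulVec6 {ξ : Fin (n + 1) × Fin (n + 1) → 𝓞 S.K6}
    (h : (S.Mat6 n k).mulVec ξ = 0) {m : ℕ} (hm : m ≤ k) :
    Aval S.L n (S.pFun6 ξ) m S.τ = 0 := by
  have hd : (S.d6 : ℂ) ^ (2 * n + 2 * k) ≠ 0 := pow_ne_zero _ (by exact_mod_cast S.G6.den_ne_zero)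
  have h1 := S.coe_mulVec6 ξ ⟨m, Nat.lt_succ_of_le hm⟩
  rw [h] at h1
  simp only [Pi.zero_apply, map_zero, ZeroMemClass.coe_zero] at h1
  exact (mul_eq_zero.mp h1.symm).resolve_left hd

/-- **The numbers `d^{2n+2K} A_m(τ)` as algebraic integers** (any `m ≤ K`), with all conjugates
`≤ (n+1)² P Amat₆(n, K)` when `house p(λ₁,λ₂) ≤ P`.
[cite: Masser1975, §1.3 (proof of Lemma 1.10, "A_m is an algebraic number")] -/
theorem exists_Z {K : ℕ} (ξ : Fin (n + 1) × Fin (n + 1) → 𝓞 S.K6) {P : ℝ} (hP1 : 1 ≤ P)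
    (hP : ∀ ij, house ((ξ ij : 𝓞 S.K6) : S.K6) ≤ P) {m : ℕ} (hm : m ≤ K) :
    ∃ x : 𝓞 S.K6, ((x : S.K6) : ℂ) = (S.d6 : ℂ) ^ (2 * n + 2 * K) * Aval S.L n (S.pFun6 ξ) m S.τ ∧
      ∀ σ : S.K6 →+* ℂ, ‖σ (x : S.K6)‖ ≤ (((n + 1) ^ 2 : ℕ) : ℝ) * P * S.Amat6 n K := by
  classical
  set c : Fin (n + 1) × Fin (n + 1) → 𝓞 S.K6 := fun ij =>
    ⟨(S.d6 : S.K6) ^ (2 * n + 2 * K) * MvPolynomial.aeval S.G6.genK (V m ij.1 ij.2),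
      S.G6.isIntegral_den_pow_mul_aeval _ ((totalDegree_V_le _ _ _).trans (by
        have := ij.1.isLt; have := ij.2.isLt; omega))⟩ with hcdef
  have hc : ∀ ij, ((c ij : S.K6) : ℂ) = (S.d6 : ℂ) ^ (2 * n + 2 * K) * S.φ6 (V m ij.1 ij.2) := by
    intro ij
    simp only [hcdef, RingOfIntegers.map_mk]
    push_cast
    rw [coe_aeval_genK6]
  refine ⟨∑ ij, ξ ij * c ij, ?_, fun σ => ?_⟩
  · rw [Aval_tau_eq, TSetup.sum_range_range_eq_sum_fin, Finset.mul_sum]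
    push_cast
    refine Finset.sum_congr rfl fun ij _ => ?_
    rw [hc ij, pFun6_apply]
    ring
  · have hterm : ∀ ij : Fin (n + 1) × Fin (n + 1),
        ‖σ ((ξ ij * c ij : 𝓞 S.K6) : S.K6)‖ ≤ P * S.Amat6 n K := by
      intro ij
      push_cast
      rw [map_mul, norm_mul]
      refine mul_le_mul ((NumberField.norm_embedding_le_house _ σ).trans (hP ij)) ?_
        (norm_nonneg _) (zero_le_one.trans hP1)
      simp only [hcdef, RingOfIntegers.map_mk]
      exact S.norm_embedding_den_pow_mul_aeval_V_le σ (Nat.lt_succ_iff.mp ij.1.isLt)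
        (Nat.lt_succ_iff.mp ij.2.isLt) hm
    have hcard : (Finset.univ : Finset (Fin (n + 1) × Fin (n + 1))).card = (n + 1) ^ 2 := by
      simp [sq]
    calc ‖σ ((∑ ij, ξ ij * c ij : 𝓞 S.K6) : S.K6)‖ = ‖∑ ij, σ ((ξ ij * c ij : 𝓞 S.K6) : S.K6)‖ := by
          push_cast; rw [map_sum]
      _ ≤ ∑ ij, ‖σ ((ξ ij * c ij : 𝓞 S.K6) : S.K6)‖ := norm_sum_le _ _
      _ ≤ ∑ _ij : Fin (n + 1) × Fin (n + 1), P * S.Amat6 n K := Finset.sum_le_sum fun ij _ => hterm ij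
      _ = (((n + 1) ^ 2 : ℕ) : ℝ) * P * S.Amat6 n K := by
          rw [Finset.sum_const, hcard, nsmul_eq_mul]; push_cast; ring

end System

/-! ### Liouville's inequality for `A + Bτ + Cτ²` -/

/-- **Lower bound for the quadratic form at `τ`**: for `(A, B, C) ≠ 0` with `|A|, |B|, |C| ≤ X`
(`X ≥ 1`), `|A + Bτ + Cτ²| ≥ ((3 X C₆²)^{h-1} d²)⁻¹` (the algebraic integer `d²(A + Bτ + Cτ²) ≠ 0`
has conjugates `≤ 3 X C₆²`). [cite: Masser1975, §1.3 (end of the proof of Thm I, "μ > H^{-c₂₉}")] -/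
theorem norm_quadForm_tau_ge {A B C : ℤ} (h0 : (A, B, C) ≠ (0, 0, 0)) {X : ℕ} (hX : 1 ≤ X)
    (hA : |A| ≤ X) (hB : |B| ≤ X) (hC : |C| ≤ X) :
    ((3 * (X : ℝ) * S.C6 ^ 2) ^ (S.G6.h - 1) * (S.d6 : ℝ) ^ 2)⁻¹ ≤
      ‖(A : ℂ) + (B : ℂ) * S.τ + (C : ℂ) * S.τ ^ 2‖ := by
  -- the algebraic integer `x = d²(A + Bτ + Cτ²)`
  set t : S.K6 := (S.d6 : S.K6) * S.G6.genK 5 with ht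
  have htint : IsIntegral ℤ t := S.G6.isIntegral_den_mul_genK 5
  have hdint : IsIntegral ℤ (S.d6 : S.K6) := S.G6.isIntegral_intCast_K _
  let x : 𝓞 S.K6 := ⟨(A : S.K6) * (S.d6 : S.K6) ^ 2 + (B : S.K6) * (S.d6 : S.K6) * t + (C : S.K6) * t ^ 2,
    (((S.G6.isIntegral_intCast_K A).mul (hdint.pow 2)).add
      (((S.G6.isIntegral_intCast_K B).mul hdint).mul htint)).add ((S.G6.isIntegral_intCast_K C).mul (htint.pow 2))⟩
  have hτ : ((S.G6.genK 5 : S.K6) : ℂ) = S.τ := rfl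
  have hxc : ((x : S.K6) : ℂ) = (S.d6 : ℂ) ^ 2 * ((A : ℂ) + (B : ℂ) * S.τ + (C : ℂ) * S.τ ^ 2) := by
    simp only [x, RingOfIntegers.map_mk, ht]
    push_cast
    rw [hτ]; ring
  have hd0 : (S.d6 : ℂ) ≠ 0 := by exact_mod_cast S.G6.den_ne_zero
  have hq0 : (A : ℂ) + (B : ℂ) * S.τ + (C : ℂ) * S.τ ^ 2 ≠ 0 := S.hdeg A B C h0
  have hx0 : x ≠ 0 := by
    intro h
    have : ((x : S.K6) : ℂ) = 0 := by rw [h]; simp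
    rw [hxc] at this
    exact (mul_ne_zero (pow_ne_zero 2 hd0) hq0) this
  -- conjugate bounds
  have hM := S.G6.one_le_M
  have hX1 : (1 : ℝ) ≤ X := by exact_mod_cast hX
  have hconj : ∀ σ : S.K6 →+* ℂ, ‖σ (x : S.K6)‖ ≤ 3 * (X : ℝ) * S.C6 ^ 2 := by
    intro σ
    have hσt : ‖σ t‖ ≤ S.C6 := by
      rw [ht, map_mul, norm_mul, map_intCast, Complex.norm_intCast]
      unfold C6
      exact mul_le_mul_of_nonneg_left (S.G6.norm_embedding_genK_le σ 5) (abs_nonneg _)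
    have hσd : ‖σ (S.d6 : S.K6)‖ = |(S.d6 : ℝ)| := by rw [map_intCast, Complex.norm_intCast]
    have hdC : |(S.d6 : ℝ)| ≤ S.C6 := by
      unfold C6; exact le_mul_of_one_le_right (abs_nonneg _) hM
    have hC60 : 0 ≤ S.C6 := zero_le_one.trans S.one_le_C6
    have hA' : ‖σ (A : S.K6)‖ ≤ X := by rw [map_intCast, Complex.norm_intCast, ← Int.cast_abs]; exact_mod_cast hA
    have hB' : ‖σ (B : S.K6)‖ ≤ X := by rw [map_intCast, Complex.norm_intCast, ← Int.cast_abs]; exact_mod_cast hB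
    have hC' : ‖σ (C : S.K6)‖ ≤ X := by rw [map_intCast, Complex.norm_intCast, ← Int.cast_abs]; exact_mod_cast hC
    simp only [x, RingOfIntegers.map_mk, map_add, map_mul, map_pow]
    have e1 : ‖σ (A : S.K6) * σ (S.d6 : S.K6) ^ 2‖ ≤ X * S.C6 ^ 2 := by
      rw [norm_mul, norm_pow, hσd]
      exact mul_le_mul hA' (pow_le_pow_left₀ (abs_nonneg _) hdC 2) (by positivity) (by positivity)
    have e2 : ‖σ (B : S.K6) * σ (S.d6 : S.K6) * σ t‖ ≤ X * S.C6 ^ 2 := by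
      rw [norm_mul, norm_mul, hσd]
      calc ‖σ (B : S.K6)‖ * |(S.d6 : ℝ)| * ‖σ t‖ ≤ X * S.C6 * S.C6 :=
            mul_le_mul (mul_le_mul hB' hdC (abs_nonneg _) (by positivity)) hσt (norm_nonneg _) (by positivity)
        _ = X * S.C6 ^ 2 := by ring
    have e3 : ‖σ (C : S.K6) * σ t ^ 2‖ ≤ X * S.C6 ^ 2 := by
      rw [norm_mul, norm_pow]
      exact mul_le_mul hC' (pow_le_pow_left₀ (norm_nonneg _) hσt 2) (by positivity) (by positivity)
    calc _ ≤ ‖σ (A : S.K6) * σ (S.d6 : S.K6) ^ 2‖ + ‖σ (B : S.K6) * σ (S.d6 : S.K6) * σ t‖ + ‖σ (C : S.K6) * σ t ^ 2‖ :=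
          norm_add₃_le
      _ ≤ X * S.C6 ^ 2 + X * S.C6 ^ 2 + X * S.C6 ^ 2 := add_le_add (add_le_add e1 e2) e3
      _ = 3 * (X : ℝ) * S.C6 ^ 2 := by ring
  have hB1 : (1 : ℝ) ≤ 3 * (X : ℝ) * S.C6 ^ 2 := by
    have : (1 : ℝ) ≤ S.C6 ^ 2 := one_le_pow₀ S.one_le_C6
    nlinarith
  have hliou := S.G6.norm_ge_of_forall_norm_le hx0 hB1 hconj
  rw [hxc, norm_mul, norm_pow, Complex.norm_intCast] at hliou
  -- divide by `d²`
  have hd2 : 0 < |(S.d6 : ℝ)| ^ 2 := pow_pos (lt_of_lt_of_le one_pos S.G6.one_le_abs_den) 2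
  have key : ((3 * (X : ℝ) * S.C6 ^ 2) ^ (S.G6.h - 1))⁻¹ / |(S.d6 : ℝ)| ^ 2 ≤
      ‖(A : ℂ) + (B : ℂ) * S.τ + (C : ℂ) * S.τ ^ 2‖ := by
    rw [div_le_iff₀ hd2]; linarith [hliou]
  calc ((3 * (X : ℝ) * S.C6 ^ 2) ^ (S.G6.h - 1) * (S.d6 : ℝ) ^ 2)⁻¹
      = ((3 * (X : ℝ) * S.C6 ^ 2) ^ (S.G6.h - 1))⁻¹ / |(S.d6 : ℝ)| ^ 2 := by
        rw [mul_inv, sq_abs, div_eq_mul_inv]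
    _ ≤ _ := key

end ASetup

end Literature.NumberTheory.Transcendental.Masser1975
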